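import Literature.AlgebraicGeometry.Deformation.SmoothSchemeLiftObstructionCriterionGluePullback
import Literature.AlgebraicGeometry.Deformation.FlatDeformationGluedIso
import Literature.AlgebraicGeometry.Deformation.FlatDeformationTransitionDataCover
import Literature.AlgebraicGeometry.Deformation.SmoothSchemeLiftObstructionCriterion
import Literature.AlgebraicGeometry.Deformation.SmoothSchemeLiftObstructionCechCocycleIdentity
import Literature.AlgebraicGeometry.Morphisms.NilpotentThickeningCoverLift
import Literature.AlgebraicGeometry.Morphisms.ProperOfSurjectiveComp
import Literature.AlgebraicGeometry.AbelianSchemes.AbelianSchemeOverBase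
import Literature.AlgebraicGeometry.Deformation.CoefficientFieldOfArtinLocal
import Literature.AlgebraicGeometry.AbelianSchemes.AbelianSchemeStructureOnLift
import Literature.AlgebraicGeometry.Deformation.SmoothSchemeLiftTransitionDataLift
import Literature.AlgebraicGeometry.AbelianSchemes.ArtinLocalFibreProjectiveCover
import Literature.AlgebraicGeometry.AbelianSchemes.AbelianSchemeQuotientMulNDescent
import Literature.AlgebraicGeometry.Modules.FiniteFrameProjections
import Literature.AlgebraicGeometry.Morphisms.CechModuleH2RefinementInjective
import Literature.AlgebraicGeometry.Morphisms.PrincipalAffineCoverRefinement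
import Literature.AlgebraicGeometry.Morphisms.CechModuleH2ScalingVanishing
import Literature.AlgebraicGeometry.Morphisms.CechModuleUnitH2Pullback
import Literature.AlgebraicGeometry.Morphisms.PrincipalAffineCoverBasicOpenRefinement
import Literature.AlgebraicGeometry.AbelianSchemes.AbelianSchemeOverMulNEtale
import Literature.AlgebraicGeometry.AbelianSchemes.ClosedFibreBaseChangeCover
import Literature.AlgebraicGeometry.Deformation.SmoothSchemeLiftChartIntertwiners
import Literature.AlgebraicGeometry.Deformation.AbelianObstructionMulTwoRefine
import Literature.AlgebraicGeometry.Deformation.SmoothSchemeLiftChartMapsOfMorphism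
import Literature.AlgebraicGeometry.AbelianSchemes.AbelianSchemeOverMulNUnramified
import Literature.AlgebraicGeometry.Deformation.SmoothSchemeLiftObstructionCoboundaryOfScaling
import HarnessLib

/-!
# The obstruction to lifting an abelian scheme over a principal small extension is a Čech coboundary (GAP-2 of MONO-G1), modulo the scaling relation `[2]^* = 4` on `Ȟ²(𝒪)`

Layer `Literature/AlgebraicGeometry/Deformation`, namespace `Literature.AlgebraicGeometry.Deformation`.  THEOREMS ONLY (no `def`, no
instance, no notation, no named fact, no `sorry`); universe `0` for the closer (§2).  Cell `hodgecm-mathlib` (D-0151 ∕ FLOOR 0), F-11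
sub-line `F11SmoothRoadA` → grandchild `F11LiftWithLineBundle`, letter G1-P `stub_abelianLift` (MONO-G1 integrator F0P1c-p05 (g2),
file of record `F11StubG1AbelianLift` v5b, ONE socket `socket_GAP2_abelian_datum`): THIS FILE is that socket's body, assembled
from the slots of the (iv) road (a′) «abelian varieties are unobstructed» — count-neutral (`--supports stmt-HodgeConjecture-24835`);
HC_CM is proved only modulo the 7 printed citations until rung 0 closes, and nothing here bears on it.

THE PRINT.  [Oort1971] §2.2 (Thm. 2.2.1 and its proof) ∕ [MumfordAV1970] §13 Cor. 2: for an abelian scheme `A₀` over `A ⧸ J`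
(`J` a principal ideal killed by the maximal ideal of the Artin local `ℚ`-algebra `A`), the obstruction `o ∈ Ȟ²(A₀ ⊗ k, 𝒯) ⊗ J` to
lifting `A₀` over `A` vanishes, because `[2]^*` acts on it both as `2` (functoriality of the obstruction under the isogeny `[2]`,
whose differential is `2`) and as `4` (`Ȟ²(𝒪) = Λ²Ȟ¹(𝒪)` and `[2]^* = 2` on `Ȟ¹`) — [Hartshorne2010] Thm. 10.2 (proof) for
the obstruction cochain of lifted gluing data.

## §1 The assembly from the slots = ★ `Deformation/SmoothSchemeLiftObstructionCoboundaryOfScaling` (F0P1b-p05 (g0), p801120), BY IMPORT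
`obstructionCochain_mem_cechMZ2` (★ F2-B's cocycle identity read in `Ž²`), `GAP2_of_slots` (frame `π σ` + refinement `W` + cocycles
`p a, q a` with `[p a] = 2•[q a]`, `[q a] = [π_a o|_W]`, `[p a] = 4•[π_a o|_W]` ⇒ `o ∈ B̌²` by ★ `Morphisms/CechModuleH2ScalingVanishing`),
`exists_cechMD1_eq_of_scaling_slots`.

## §2 The socket body (B-p14 (g21), with F0P1a-p04 (g2)'s (D2) plug)
`exists_cechMD1_eq_of_abelian_datum_of_scaling`: the MONO-G1 socket letter `socket_GAP2_abelian_datum` (F0P1b-p06 (g0) cert v3 :201,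
binders VERBATIM: coefficient field, principal small extension, augmentation `π'`, abelian `A₀` of relative dimension `g`, its closed
fibre `B := A₀ ×_{A⧸J} k` LITERALLY, principal affine covers `U' ∕ U`, ★ c2b chart data, ★ GAP-1 lifts `ψ`, ★ F2-A obstruction
cochain `o`) ⟹ `∃ γ, d¹γ = o`, MODULO ONE NAMED HYPOTHESIS `hrel₃` = slot (5) «`[2]^* = (2·2) •` on `Ȟ²(W, 𝒪)` for the cocycles
`[2]^*z|_W`, `z|_W` on the two-sided basic-open refinement `W`» (F0P1b-p01 (g2) road N1∕N2∕N3′∕N4; a sequel discharges it).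
Body: seams (`CharZero k`, `IsOfRelDim.baseChange`, `CompactSpace`), the closed fibre (★ `ClosedFibreBaseChangeCover`), `[2]`
finite (★ `isFinite_pow_id_left_of_charZero`), the naturality square `[2]_B ≫ i₀ = i₀ ≫ [2]_{A₀}` (★ `map_id_pow'`), the SECOND
ATLAS on `[2]⁻¹U' ∕ [2]⁻¹U` (★ c2b `exists_transition_data_of_cover` → ★ GAP-1 `exists_lifts_of_transition_data` → ★ F2-A
`exists_obstructionCochain`), the two-sided refinement (★ `exists_finite_principal_affine_cover_basicOpen_refinement₂`), the tangent
frame (★ `exists_frameMaps_tangentSheaf_of_isLocalRing`), the chart-lift maps of `[2]` (★ `exists_chartLifts_of_morphism`, (D2)),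
then rel₁ = ★ `AbelianSchemeOver.cechMH2_mk_refine_comap_mulN_two_map_eq_two_smul` (B-p03 (g21)), rel₂ = ★
`CechMH2.mk_refineC2_mapC2_eq_of_two_covers_of_charts` (F0P1a-p04 (g2)), rel₃ = `hrel₃`, and ★ `exists_cechMD1_eq_of_scaling_slots`.

## References
* [Oort1971] F. Oort, *Finite group schemes, local moduli for abelian varieties, and lifting problems*, Compositio Math. 23 (1971),
  §2.2 (Thm. 2.2.1 and its proof).
* [MumfordAV1970] D. Mumford, *Abelian Varieties* (1970), §13 Cor. 2.
* [Hartshorne2010] R. Hartshorne, *Deformation Theory*, GTM 257 (2010), Thm. 10.2 (proof), p. 81.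
-/

/-! ## §2 The socket body — GAP-2 for the abelian datum, modulo `hrel₃` (B-p14 (g21); (D2) plug F0P1a-p04 (g2) ∕ F0P1c-p01 (g3)) -/

noncomputable section

set_option backward.isDefEq.respectTransparency false

open CategoryTheory CategoryTheory.Limits AlgebraicGeometry Opposite TopologicalSpace
open scoped TensorProduct

namespace Literature.AlgebraicGeometry.Deformation

open Literature.AlgebraicGeometry.AbelianSchemes Literature.AlgebraicGeometry.Morphisms Literature.AlgebraicGeometry.Motives
  Literature.AlgebraicGeometry.Modules Literature.AlgebraicGeometry.HodgeTheory SmoothAffineDeformation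

set_option maxHeartbeats 1600000 in
/-- **GAP-2 for the abelian datum, modulo the scaling relation**: for the MONO-G1 socket data (coefficient field `k ⊆ A`, principal
small extension `J`, augmentation `π'` of `A ⧸ J`, abelian scheme `A₀` over `A ⧸ J` of relative dimension `g`, its closed fibre
`A₀ ×_{A⧸J} k`, principal affine covers, ★ c2b chart data, ★ GAP-1 lifts `ψ` over `A`, ★ F2-A obstruction cochain `o`), IF `[2]^*`
acts as `2·2` on the classes of the `2`-cocycles of `𝒪` on the common refinements (`hrel₃`), THEN `o = d¹γ` is a Čech coboundary.
rel₁ (`[2]^*[π_a o] = 2•[π_a o₂]`) and rel₂ (`[π_a o₂] = [π_a o]`) are discharged inside over the second atlas on `[2]⁻¹U`.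
[cite: Oort1971, §2.2 (Thm. 2.2.1 and its proof)] [cite: MumfordAV1970, §13 Cor. 2] [cite: Hartshorne2010, Thm. 10.2 (proof), p. 81] -/
theorem exists_cechMD1_eq_of_abelian_datum_of_scaling
    {A : Type} [CommRing A] [Algebra ℚ A] [IsArtinianRing A] [IsLocalRing A] {k : Type} [Field k] [Algebra k A]
    (_hk : Function.Surjective (⇑(IsLocalRing.residue A) ∘ ⇑(algebraMap k A)))
    {J : Ideal A} (hJ : J ≠ ⊤) (hmJ : IsLocalRing.maximalIdeal A * J = ⊥) (eJ : ↥(J.restrictScalars k) ≃ₗ[k] k)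
    [IsArtinianRing (A ⧸ J)] [IsLocalRing (A ⧸ J)]
    (π' : (A ⧸ J) →ₐ[k] k) (hπ'nil : IsNilpotent (RingHom.ker π'))
    (hπ'max : (RingHom.ker π').comap (Ideal.Quotient.mk J) = IsLocalRing.maximalIdeal A)
    (A₀ : AbelianSchemeOver (Spec (.of (A ⧸ J)))) {g : ℕ} (hA₀ : A₀.IsOfRelDim g)
    -- the CLOSED FIBRE, LITERALLY (★ p797210's witnesses): `X := (A₀.baseChange s).X`, `i₀ := pullback.fst A₀.X.hom s`,
    -- `s := Spec.map (CommRingCat.ofHom π'.toRingHom)` — an abelian variety over `k` of dimension `g` BY CONSTRUCTION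
    [instΓ : ∀ W : (A₀.baseChange (Spec.map (CommRingCat.ofHom π'.toRingHom))).X.left.Opens, Algebra k Γ((A₀.baseChange (Spec.map (CommRingCat.ofHom π'.toRingHom))).X.left, W)]
    (halg : ∀ (W : (A₀.baseChange (Spec.map (CommRingCat.ofHom π'.toRingHom))).X.left.Opens) (s : k), algebraMap k Γ((A₀.baseChange (Spec.map (CommRingCat.ofHom π'.toRingHom))).X.left, W) s = (constToPresheaf (A₀.baseChange (Spec.map (CommRingCat.ofHom π'.toRingHom))).X).app (op W) s)
    [instΓA : ∀ W : A₀.X.left.Opens, Algebra (A ⧸ J) Γ(A₀.X.left, W)]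
    (halgA : ∀ (W : A₀.X.left.Opens) (a : A ⧸ J), algebraMap (A ⧸ J) Γ(A₀.X.left, W) a = (constToPresheaf A₀.X).app (op W) a)
    {ι : Type} (U' : ι → A₀.X.left.affineOpens) (b' : (j l : ι) → Γ(A₀.X.left, (U' j).1))
    (hb' : ∀ j l, (U' j).1 ⊓ (U' l).1 = A₀.X.left.basicOpen (b' j l)) (hU'cov : IsOpenCover fun j => (U' j).1)
    (U : ι → (A₀.baseChange (Spec.map (CommRingCat.ofHom π'.toRingHom))).X.left.affineOpens) (hU : ∀ j, (U j).1 = (pullback.fst A₀.X.hom (Spec.map (CommRingCat.ofHom π'.toRingHom))) ⁻¹ᵁ (U' j).1)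
    (b : (j l : ι) → Γ((A₀.baseChange (Spec.map (CommRingCat.ofHom π'.toRingHom))).X.left, (U j).1)) (hb : ∀ j l, (U j).1 ⊓ (U l).1 = (A₀.baseChange (Spec.map (CommRingCat.ofHom π'.toRingHom))).X.left.basicOpen (b j l))
    -- ★ c2b chart data of `A₀.X` on the cover and their ties to `A₀.X`
    (e : ∀ j, (A ⧸ J) ⊗[k] Γ((A₀.baseChange (Spec.map (CommRingCat.ofHom π'.toRingHom))).X.left, (U j).1) ≃ₐ[A ⧸ J] Γ(A₀.X.left, (U' j).1))
    (ε₁ ε₂ : ∀ j l, (A ⧸ J) ⊗[k] Γ((A₀.baseChange (Spec.map (CommRingCat.ofHom π'.toRingHom))).X.left, (U j).1 ⊓ (U l).1) ≃ₐ[A ⧸ J] Γ(A₀.X.left, (U' j).1 ⊓ (U' l).1))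
    (he : ∀ j x, (pullback.fst A₀.X.hom (Spec.map (CommRingCat.ofHom π'.toRingHom))).appLE (U' j).1 (U j).1 (hU j).le (e j x) = specialFibreHom π' _ x)
    (hε₁ : ∀ j l (a : A ⧸ J) (s : Γ((A₀.baseChange (Spec.map (CommRingCat.ofHom π'.toRingHom))).X.left, (U j).1)),
      ε₁ j l (a ⊗ₜ (A₀.baseChange (Spec.map (CommRingCat.ofHom π'.toRingHom))).X.left.presheaf.map (homOfLE inf_le_left).op s) =
        A₀.X.left.presheaf.map (homOfLE inf_le_left).op (e j (a ⊗ₜ s)))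
    (hε₂ : ∀ j l (a : A ⧸ J) (s : Γ((A₀.baseChange (Spec.map (CommRingCat.ofHom π'.toRingHom))).X.left, (U l).1)),
      ε₂ j l (a ⊗ₜ (A₀.baseChange (Spec.map (CommRingCat.ofHom π'.toRingHom))).X.left.presheaf.map (homOfLE inf_le_right).op s) =
        A₀.X.left.presheaf.map (homOfLE inf_le_right).op (e l (a ⊗ₜ s)))
    (_hε₁' : ∀ j l y, (pullback.fst A₀.X.hom (Spec.map (CommRingCat.ofHom π'.toRingHom))).appLE ((U' j).1 ⊓ (U' l).1) ((U j).1 ⊓ (U l).1)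
        (by rw [hU, hU]; exact ((pullback.fst A₀.X.hom (Spec.map (CommRingCat.ofHom π'.toRingHom))).preimage_inf).ge) (ε₁ j l y) = specialFibreHom π' _ y)
    (_hε₂' : ∀ j l y, (pullback.fst A₀.X.hom (Spec.map (CommRingCat.ofHom π'.toRingHom))).appLE ((U' j).1 ⊓ (U' l).1) ((U j).1 ⊓ (U l).1)
        (by rw [hU, hU]; exact ((pullback.fst A₀.X.hom (Spec.map (CommRingCat.ofHom π'.toRingHom))).preimage_inf).ge) (ε₂ j l y) = specialFibreHom π' _ y)
    (hφ : ∀ j l x, transition (ε₁ j l) (ε₂ j l) x - x ∈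
      (RingHom.ker π') • (⊤ : Submodule (A ⧸ J) ((A ⧸ J) ⊗[k] Γ((A₀.baseChange (Spec.map (CommRingCat.ofHom π'.toRingHom))).X.left, (U j).1 ⊓ (U l).1))))
    (_hcocφ : ∀ (j l m : ι)
      (Φjl : (A ⧸ J) ⊗[k] Γ((A₀.baseChange (Spec.map (CommRingCat.ofHom π'.toRingHom))).X.left, (U j).1 ⊓ (U l).1) →ₐ[A ⧸ J] (A ⧸ J) ⊗[k] Γ((A₀.baseChange (Spec.map (CommRingCat.ofHom π'.toRingHom))).X.left, (U j).1 ⊓ (U l).1 ⊓ (U m).1))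
      (_ : ∀ a s, Φjl (a ⊗ₜ s) = a ⊗ₜ (A₀.baseChange (Spec.map (CommRingCat.ofHom π'.toRingHom))).X.left.presheaf.map (homOfLE inf_le_left).op s)
      (Φlm : (A ⧸ J) ⊗[k] Γ((A₀.baseChange (Spec.map (CommRingCat.ofHom π'.toRingHom))).X.left, (U l).1 ⊓ (U m).1) →ₐ[A ⧸ J] (A ⧸ J) ⊗[k] Γ((A₀.baseChange (Spec.map (CommRingCat.ofHom π'.toRingHom))).X.left, (U j).1 ⊓ (U l).1 ⊓ (U m).1))
      (_ : ∀ a s, Φlm (a ⊗ₜ s) = a ⊗ₜ (A₀.baseChange (Spec.map (CommRingCat.ofHom π'.toRingHom))).X.left.presheaf.map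
        (homOfLE (le_inf (inf_le_left.trans inf_le_right) inf_le_right)).op s)
      (Φjm : (A ⧸ J) ⊗[k] Γ((A₀.baseChange (Spec.map (CommRingCat.ofHom π'.toRingHom))).X.left, (U j).1 ⊓ (U m).1) →ₐ[A ⧸ J] (A ⧸ J) ⊗[k] Γ((A₀.baseChange (Spec.map (CommRingCat.ofHom π'.toRingHom))).X.left, (U j).1 ⊓ (U l).1 ⊓ (U m).1))
      (_ : ∀ a s, Φjm (a ⊗ₜ s) = a ⊗ₜ (A₀.baseChange (Spec.map (CommRingCat.ofHom π'.toRingHom))).X.left.presheaf.map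
        (homOfLE (le_inf (inf_le_left.trans inf_le_left) inf_le_right)).op s)
      (ρjl ρlm ρjm : (A ⧸ J) ⊗[k] Γ((A₀.baseChange (Spec.map (CommRingCat.ofHom π'.toRingHom))).X.left, (U j).1 ⊓ (U l).1 ⊓ (U m).1) ≃ₐ[A ⧸ J] (A ⧸ J) ⊗[k] Γ((A₀.baseChange (Spec.map (CommRingCat.ofHom π'.toRingHom))).X.left, (U j).1 ⊓ (U l).1 ⊓ (U m).1)),
      (∀ x, ρjl (Φjl x) = Φjl (transition (ε₁ j l) (ε₂ j l) x)) →
      (∀ x, ρlm (Φlm x) = Φlm (transition (ε₁ l m) (ε₂ l m) x)) →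
      (∀ x, ρjm (Φjm x) = Φjm (transition (ε₁ j m) (ε₂ j m) x)) → ρlm * ρjl = ρjm)
    -- ★ GAP-1 lifted data over `A`, reducing to `φ`
    (ψ : (j l : ι) → A ⊗[k] Γ((A₀.baseChange (Spec.map (CommRingCat.ofHom π'.toRingHom))).X.left, (U j).1 ⊓ (U l).1) ≃ₐ[A] A ⊗[k] Γ((A₀.baseChange (Spec.map (CommRingCat.ofHom π'.toRingHom))).X.left, (U j).1 ⊓ (U l).1))
    (hL : ∀ j l x, Algebra.TensorProduct.map (Ideal.Quotient.mkₐ k J) (AlgHom.id k Γ((A₀.baseChange (Spec.map (CommRingCat.ofHom π'.toRingHom))).X.left, (U j).1 ⊓ (U l).1)) (ψ j l x) =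
      transition (ε₁ j l) (ε₂ j l)
        (Algebra.TensorProduct.map (Ideal.Quotient.mkₐ k J) (AlgHom.id k Γ((A₀.baseChange (Spec.map (CommRingCat.ofHom π'.toRingHom))).X.left, (U j).1 ⊓ (U l).1)) x))
    (hψ : ∀ j l x, ψ j l x - x ∈
      ((RingHom.ker π').comap (Ideal.Quotient.mk J)) • (⊤ : Submodule A (A ⊗[k] Γ((A₀.baseChange (Spec.map (CommRingCat.ofHom π'.toRingHom))).X.left, (U j).1 ⊓ (U l).1))))
    (_hcoc : ∀ (j l m : ι)
      (Φjl : A ⊗[k] Γ((A₀.baseChange (Spec.map (CommRingCat.ofHom π'.toRingHom))).X.left, (U j).1 ⊓ (U l).1) →ₐ[A] A ⊗[k] Γ((A₀.baseChange (Spec.map (CommRingCat.ofHom π'.toRingHom))).X.left, (U j).1 ⊓ (U l).1 ⊓ (U m).1))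
      (_ : ∀ a s, Φjl (a ⊗ₜ s) = a ⊗ₜ (A₀.baseChange (Spec.map (CommRingCat.ofHom π'.toRingHom))).X.left.presheaf.map (homOfLE inf_le_left).op s)
      (Φlm : A ⊗[k] Γ((A₀.baseChange (Spec.map (CommRingCat.ofHom π'.toRingHom))).X.left, (U l).1 ⊓ (U m).1) →ₐ[A] A ⊗[k] Γ((A₀.baseChange (Spec.map (CommRingCat.ofHom π'.toRingHom))).X.left, (U j).1 ⊓ (U l).1 ⊓ (U m).1))
      (_ : ∀ a s, Φlm (a ⊗ₜ s) = a ⊗ₜ (A₀.baseChange (Spec.map (CommRingCat.ofHom π'.toRingHom))).X.left.presheaf.map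
        (homOfLE (le_inf (inf_le_left.trans inf_le_right) inf_le_right)).op s)
      (Φjm : A ⊗[k] Γ((A₀.baseChange (Spec.map (CommRingCat.ofHom π'.toRingHom))).X.left, (U j).1 ⊓ (U m).1) →ₐ[A] A ⊗[k] Γ((A₀.baseChange (Spec.map (CommRingCat.ofHom π'.toRingHom))).X.left, (U j).1 ⊓ (U l).1 ⊓ (U m).1))
      (_ : ∀ a s, Φjm (a ⊗ₜ s) = a ⊗ₜ (A₀.baseChange (Spec.map (CommRingCat.ofHom π'.toRingHom))).X.left.presheaf.map
        (homOfLE (le_inf (inf_le_left.trans inf_le_left) inf_le_right)).op s)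
      (ρjl ρlm ρjm : A ⊗[k] Γ((A₀.baseChange (Spec.map (CommRingCat.ofHom π'.toRingHom))).X.left, (U j).1 ⊓ (U l).1 ⊓ (U m).1) ≃ₐ[A] A ⊗[k] Γ((A₀.baseChange (Spec.map (CommRingCat.ofHom π'.toRingHom))).X.left, (U j).1 ⊓ (U l).1 ⊓ (U m).1)),
      (∀ x, ρjl (Φjl x) = Φjl (ψ j l x)) → (∀ x, ρlm (Φlm x) = Φlm (ψ l m x)) →
      (∀ x, ρjm (Φjm x) = Φjm (ψ j m x)) →
      ∀ y, (ρlm * ρjl * ρjm⁻¹) y - y ∈ J • (⊤ : Submodule A (A ⊗[k] Γ((A₀.baseChange (Spec.map (CommRingCat.ofHom π'.toRingHom))).X.left, (U j).1 ⊓ (U l).1 ⊓ (U m).1))))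
    -- ★ F2 A obstruction cochain of `ψ` (coefficient line `eJ`)
    (o : CechMC2 (A₀.baseChange (Spec.map (CommRingCat.ofHom π'.toRingHom))).X.hom (tangentSheaf (A₀.baseChange (Spec.map (CommRingCat.ofHom π'.toRingHom))).X) (fun j => (U j).1))
    (ho : ∀ (j l m : ι)
      (Φjl : A ⊗[k] Γ((A₀.baseChange (Spec.map (CommRingCat.ofHom π'.toRingHom))).X.left, (U j).1 ⊓ (U l).1) →ₐ[A] A ⊗[k] Γ((A₀.baseChange (Spec.map (CommRingCat.ofHom π'.toRingHom))).X.left, (U j).1 ⊓ (U l).1 ⊓ (U m).1))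
      (_ : ∀ a s, Φjl (a ⊗ₜ s) = a ⊗ₜ (A₀.baseChange (Spec.map (CommRingCat.ofHom π'.toRingHom))).X.left.presheaf.map (homOfLE inf_le_left).op s)
      (Φlm : A ⊗[k] Γ((A₀.baseChange (Spec.map (CommRingCat.ofHom π'.toRingHom))).X.left, (U l).1 ⊓ (U m).1) →ₐ[A] A ⊗[k] Γ((A₀.baseChange (Spec.map (CommRingCat.ofHom π'.toRingHom))).X.left, (U j).1 ⊓ (U l).1 ⊓ (U m).1))
      (_ : ∀ a s, Φlm (a ⊗ₜ s) = a ⊗ₜ (A₀.baseChange (Spec.map (CommRingCat.ofHom π'.toRingHom))).X.left.presheaf.map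
        (homOfLE (le_inf (inf_le_left.trans inf_le_right) inf_le_right)).op s)
      (Φjm : A ⊗[k] Γ((A₀.baseChange (Spec.map (CommRingCat.ofHom π'.toRingHom))).X.left, (U j).1 ⊓ (U m).1) →ₐ[A] A ⊗[k] Γ((A₀.baseChange (Spec.map (CommRingCat.ofHom π'.toRingHom))).X.left, (U j).1 ⊓ (U l).1 ⊓ (U m).1))
      (_ : ∀ a s, Φjm (a ⊗ₜ s) = a ⊗ₜ (A₀.baseChange (Spec.map (CommRingCat.ofHom π'.toRingHom))).X.left.presheaf.map
        (homOfLE (le_inf (inf_le_left.trans inf_le_left) inf_le_right)).op s)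
      (ρjl ρlm ρjm : A ⊗[k] Γ((A₀.baseChange (Spec.map (CommRingCat.ofHom π'.toRingHom))).X.left, (U j).1 ⊓ (U l).1 ⊓ (U m).1) ≃ₐ[A] A ⊗[k] Γ((A₀.baseChange (Spec.map (CommRingCat.ofHom π'.toRingHom))).X.left, (U j).1 ⊓ (U l).1 ⊓ (U m).1)),
      (∀ x, ρjl (Φjl x) = Φjl (ψ j l x)) → (∀ x, ρlm (Φlm x) = Φlm (ψ l m x)) →
      (∀ x, ρjm (Φjm x) = Φjm (ψ j m x)) →
      ∀ c : Γ((A₀.baseChange (Spec.map (CommRingCat.ofHom π'.toRingHom))).X.left, (U j).1 ⊓ (U l).1 ⊓ (U m).1), (ρlm * ρjl * ρjm⁻¹) ((1 : A) ⊗ₜ c) =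
        (1 : A) ⊗ₜ c + ((eJ.symm 1 : ↥(J.restrictScalars k)) : A) ⊗ₜ
          (show Γ((A₀.baseChange (Spec.map (CommRingCat.ofHom π'.toRingHom))).X.left, (U j).1 ⊓ (U l).1 ⊓ (U m).1) from appLE (o j l m) (𝟙 _) (dSection (A₀.baseChange (Spec.map (CommRingCat.ofHom π'.toRingHom))).X _ c)))
    -- ===== OPEN SLOT (5) rel₃ AS A HYPOTHESIS (v1, same (BO) binder block; owner F0P1b-p01 (g2) (N1)–(N4), (iv-4): `[2]^* = 4` on `Ȟ²(𝒪)`) =====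
    (hrel₃ : ∀ (z : ↥(cechMZ2 (A₀.baseChange (Spec.map (CommRingCat.ofHom π'.toRingHom))).X.hom (SheafOfModules.unit (A₀.baseChange (Spec.map (CommRingCat.ofHom π'.toRingHom))).X.left.ringCatSheaf) (fun j => (U j).1)))
      {T : Type} (W : T → (A₀.baseChange (Spec.map (CommRingCat.ofHom π'.toRingHom))).X.left.affineOpens) (τ τ' : T → ι)
      (a : (s : T) → Γ((A₀.baseChange (Spec.map (CommRingCat.ofHom π'.toRingHom))).X.left, (U (τ s)).1))
      (a' : (s : T) → Γ((A₀.baseChange (Spec.map (CommRingCat.ofHom π'.toRingHom))).X.left, ((A₀.baseChange (Spec.map (CommRingCat.ofHom π'.toRingHom))).mulN 2).left ⁻¹ᵁ (U (τ' s)).1))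
      (hWa : ∀ s, (W s).1 = (A₀.baseChange (Spec.map (CommRingCat.ofHom π'.toRingHom))).X.left.basicOpen (a s)) (hWa' : ∀ s, (W s).1 = (A₀.baseChange (Spec.map (CommRingCat.ofHom π'.toRingHom))).X.left.basicOpen (a' s)),
      CechMH2.mk (A₀.baseChange (Spec.map (CommRingCat.ofHom π'.toRingHom))).X.hom (SheafOfModules.unit (A₀.baseChange (Spec.map (CommRingCat.ofHom π'.toRingHom))).X.left.ringCatSheaf) (fun s => (W s).1)
          ⟨cechMRefineC2 (A₀.baseChange (Spec.map (CommRingCat.ofHom π'.toRingHom))).X.hom (SheafOfModules.unit (A₀.baseChange (Spec.map (CommRingCat.ofHom π'.toRingHom))).X.left.ringCatSheaf) (preimageFamily ((A₀.baseChange (Spec.map (CommRingCat.ofHom π'.toRingHom))).mulN 2).left (fun j => (U j).1)) (fun s => (W s).1) τ'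
              (fun s => (hWa' s).le.trans ((A₀.baseChange (Spec.map (CommRingCat.ofHom π'.toRingHom))).X.left.basicOpen_le (a' s)))
              (cechComapC2 (A₀.baseChange (Spec.map (CommRingCat.ofHom π'.toRingHom))).X.hom (A₀.baseChange (Spec.map (CommRingCat.ofHom π'.toRingHom))).X.hom ((A₀.baseChange (Spec.map (CommRingCat.ofHom π'.toRingHom))).mulN 2).left (Over.w ((A₀.baseChange (Spec.map (CommRingCat.ofHom π'.toRingHom))).mulN 2)) (fun j => (U j).1)
                (z : CechMC2 (A₀.baseChange (Spec.map (CommRingCat.ofHom π'.toRingHom))).X.hom (SheafOfModules.unit (A₀.baseChange (Spec.map (CommRingCat.ofHom π'.toRingHom))).X.left.ringCatSheaf) (fun j => (U j).1))),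
            refineMC2_mem_cechMZ2 (A₀.baseChange (Spec.map (CommRingCat.ofHom π'.toRingHom))).X.hom (SheafOfModules.unit (A₀.baseChange (Spec.map (CommRingCat.ofHom π'.toRingHom))).X.left.ringCatSheaf) (preimageFamily ((A₀.baseChange (Spec.map (CommRingCat.ofHom π'.toRingHom))).mulN 2).left (fun j => (U j).1)) (fun s => (W s).1) τ'
              (fun s => (hWa' s).le.trans ((A₀.baseChange (Spec.map (CommRingCat.ofHom π'.toRingHom))).X.left.basicOpen_le (a' s)))
              (comapC2_mem_cechMZ2 (A₀.baseChange (Spec.map (CommRingCat.ofHom π'.toRingHom))).X.hom (A₀.baseChange (Spec.map (CommRingCat.ofHom π'.toRingHom))).X.hom ((A₀.baseChange (Spec.map (CommRingCat.ofHom π'.toRingHom))).mulN 2).left (Over.w ((A₀.baseChange (Spec.map (CommRingCat.ofHom π'.toRingHom))).mulN 2)) (fun j => (U j).1) z.2)⟩ =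
        ((2 : k) * 2) • CechMH2.mk (A₀.baseChange (Spec.map (CommRingCat.ofHom π'.toRingHom))).X.hom (SheafOfModules.unit (A₀.baseChange (Spec.map (CommRingCat.ofHom π'.toRingHom))).X.left.ringCatSheaf) (fun s => (W s).1)
          ⟨cechMRefineC2 (A₀.baseChange (Spec.map (CommRingCat.ofHom π'.toRingHom))).X.hom (SheafOfModules.unit (A₀.baseChange (Spec.map (CommRingCat.ofHom π'.toRingHom))).X.left.ringCatSheaf) (fun j => (U j).1) (fun s => (W s).1) τ
              (fun s => (hWa s).le.trans ((A₀.baseChange (Spec.map (CommRingCat.ofHom π'.toRingHom))).X.left.basicOpen_le (a s))) (z : CechMC2 (A₀.baseChange (Spec.map (CommRingCat.ofHom π'.toRingHom))).X.hom (SheafOfModules.unit (A₀.baseChange (Spec.map (CommRingCat.ofHom π'.toRingHom))).X.left.ringCatSheaf) (fun j => (U j).1)),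
            refineMC2_mem_cechMZ2 (A₀.baseChange (Spec.map (CommRingCat.ofHom π'.toRingHom))).X.hom (SheafOfModules.unit (A₀.baseChange (Spec.map (CommRingCat.ofHom π'.toRingHom))).X.left.ringCatSheaf) (fun j => (U j).1) (fun s => (W s).1) τ
              (fun s => (hWa s).le.trans ((A₀.baseChange (Spec.map (CommRingCat.ofHom π'.toRingHom))).X.left.basicOpen_le (a s))) z.2⟩) :
    ∃ γ : CechMC1 (A₀.baseChange (Spec.map (CommRingCat.ofHom π'.toRingHom))).X.hom (tangentSheaf (A₀.baseChange (Spec.map (CommRingCat.ofHom π'.toRingHom))).X) (fun j => (U j).1), cechMD1 (A₀.baseChange (Spec.map (CommRingCat.ofHom π'.toRingHom))).X.hom (tangentSheaf (A₀.baseChange (Spec.map (CommRingCat.ofHom π'.toRingHom))).X) (fun j => (U j).1) γ = o := by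
  -- seams S1–S3 (p06)
  haveI : CharZero (IsLocalRing.ResidueField A) := charZero_of_injective_algebraMap (algebraMap ℚ _).injective
  haveI : CharZero k := ((IsLocalRing.residue A).comp (algebraMap k A)).charZero
  have hA₀' : (A₀.baseChange (Spec.map (CommRingCat.ofHom π'.toRingHom))).IsOfRelDim g := hA₀.baseChange _
  haveI : CompactSpace (A₀.baseChange (Spec.map (CommRingCat.ofHom π'.toRingHom))).X.left := by
    haveI := (A₀.baseChange (Spec.map (CommRingCat.ofHom π'.toRingHom))).isProper
    exact QuasiCompact.compactSpace_of_compactSpace (A₀.baseChange (Spec.map (CommRingCat.ofHom π'.toRingHom))).X.hom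
  have hJJ : J * J = ⊥ := eq_bot_iff.mpr ((Ideal.mul_mono_left (IsLocalRing.le_maximalIdeal hJ)).trans hmJ.le)
  have h𝔫 : IsNilpotent ((RingHom.ker π').comap (Ideal.Quotient.mk J)) := by
    rw [hπ'max, ← IsLocalRing.jacobson_eq_maximalIdeal ⊥ bot_ne_top]
    exact IsArtinianRing.isNilpotent_jacobson_bot
  have hJ𝔫 : J * (RingHom.ker π').comap (Ideal.Quotient.mk J) = ⊥ := by rw [hπ'max, mul_comm]; exact hmJ
  -- the closed fibre: instances and the nilpotent kernel (★ F0P1c-p05 `ClosedFibreBaseChangeCover`)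
  haveI : Flat A₀.X.hom := by haveI := A₀.isSmooth; infer_instance
  haveI : Smooth (A₀.baseChange (Spec.map (CommRingCat.ofHom π'.toRingHom))).X.hom := (A₀.baseChange (Spec.map (CommRingCat.ofHom π'.toRingHom))).isSmooth
  have hi₀ : IsPullback (pullback.fst A₀.X.hom (Spec.map (CommRingCat.ofHom π'.toRingHom))) (A₀.baseChange (Spec.map (CommRingCat.ofHom π'.toRingHom))).X.hom A₀.X.hom (Spec.map (CommRingCat.ofHom π'.toRingHom)) := IsPullback.of_hasPullback _ _
  haveI : IsClosedImmersion (pullback.fst A₀.X.hom (Spec.map (CommRingCat.ofHom π'.toRingHom))) :=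
    AbelianSchemeOver.isClosedImmersion_fst_baseChange_of_retraction π' A₀
  have hnil : IsNilpotent (pullback.fst A₀.X.hom (Spec.map (CommRingCat.ofHom π'.toRingHom))).ker := AbelianSchemeOver.isNilpotent_ker_fst_baseChange π' hπ'nil A₀
  -- `[2]` on `A₀` and on the closed fibre: finite (★ `isFinite_pow_id_left_of_charZero`), hence affine
  haveI : IsFinite ((A₀.baseChange (Spec.map (CommRingCat.ofHom π'.toRingHom))).mulN 2).left := by
    rw [AbelianSchemeOver.mulN_def]
    exact (A₀.baseChange (Spec.map (CommRingCat.ofHom π'.toRingHom))).isFinite_pow_id_left_of_charZero (𝟙 (Spec (.of k))) two_ne_zero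
  haveI : IsFinite (A₀.mulN 2).left := by
    rw [AbelianSchemeOver.mulN_def]
    exact A₀.isFinite_pow_id_left_of_charZero (Spec.map (CommRingCat.ofHom (algebraMap k (A ⧸ J)))) two_ne_zero
  -- the naturality square `[2]_B ≫ i₀ = i₀ ≫ [2]_A₀` (base change is a monoidal functor: ★ `map_id_pow'`)
  have hmul : (A₀.baseChange (Spec.map (CommRingCat.ofHom π'.toRingHom))).mulN 2 = (Over.pullback (Spec.map (CommRingCat.ofHom π'.toRingHom))).map (A₀.mulN 2) := by
    rw [AbelianSchemeOver.mulN_def, AbelianSchemeOver.mulN_def, AbelianSchemeOver.map_id_pow']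
    rfl
  have hnat : ((A₀.baseChange (Spec.map (CommRingCat.ofHom π'.toRingHom))).mulN 2).left ≫ pullback.fst A₀.X.hom (Spec.map (CommRingCat.ofHom π'.toRingHom)) = pullback.fst A₀.X.hom (Spec.map (CommRingCat.ofHom π'.toRingHom)) ≫ (A₀.mulN 2).left := by
    rw [hmul]
    exact pullback.lift_fst _ _ _
  -- the second principal affine covers `U₂' := [2]⁻¹U'` upstairs and `U₂ := [2]⁻¹U` on the closed fibre
  let U₂' : ι → A₀.X.left.affineOpens := fun j => ⟨(A₀.mulN 2).left ⁻¹ᵁ (U' j).1, (U' j).2.preimage _⟩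
  let b₂' : (j l : ι) → Γ(A₀.X.left, (U₂' j).1) := fun j l => (A₀.mulN 2).left.app (U' j).1 (b' j l)
  have hb₂' : ∀ j l, (U₂' j).1 ⊓ (U₂' l).1 = A₀.X.left.basicOpen (b₂' j l) := fun j l => by
    show (A₀.mulN 2).left ⁻¹ᵁ (U' j).1 ⊓ (A₀.mulN 2).left ⁻¹ᵁ (U' l).1 = _
    rw [← Scheme.Hom.preimage_inf, hb' j l, Scheme.preimage_basicOpen]
  let U₂ : ι → (A₀.baseChange (Spec.map (CommRingCat.ofHom π'.toRingHom))).X.left.affineOpens := fun j => ⟨((A₀.baseChange (Spec.map (CommRingCat.ofHom π'.toRingHom))).mulN 2).left ⁻¹ᵁ (U j).1, (U j).2.preimage _⟩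
  have hU₂ : ∀ j, (U₂ j).1 = (pullback.fst A₀.X.hom (Spec.map (CommRingCat.ofHom π'.toRingHom))) ⁻¹ᵁ (U₂' j).1 := fun j => by
    show ((A₀.baseChange (Spec.map (CommRingCat.ofHom π'.toRingHom))).mulN 2).left ⁻¹ᵁ (U j).1 = (pullback.fst A₀.X.hom (Spec.map (CommRingCat.ofHom π'.toRingHom))) ⁻¹ᵁ ((A₀.mulN 2).left ⁻¹ᵁ (U' j).1)
    rw [hU j, ← Scheme.Hom.comp_preimage, ← Scheme.Hom.comp_preimage, hnat]
  let b₂ : (j l : ι) → Γ((A₀.baseChange (Spec.map (CommRingCat.ofHom π'.toRingHom))).X.left, (U₂ j).1) := fun j l => ((A₀.baseChange (Spec.map (CommRingCat.ofHom π'.toRingHom))).mulN 2).left.app (U j).1 (b j l)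
  have hb₂ : ∀ j l, (U₂ j).1 ⊓ (U₂ l).1 = (A₀.baseChange (Spec.map (CommRingCat.ofHom π'.toRingHom))).X.left.basicOpen (b₂ j l) := fun j l => by
    show ((A₀.baseChange (Spec.map (CommRingCat.ofHom π'.toRingHom))).mulN 2).left ⁻¹ᵁ (U j).1 ⊓ ((A₀.baseChange (Spec.map (CommRingCat.ofHom π'.toRingHom))).mulN 2).left ⁻¹ᵁ (U l).1 = _
    rw [← Scheme.Hom.preimage_inf, hb j l, Scheme.preimage_basicOpen]
  -- ★ c2b on the second cover
  obtain ⟨e₂, ε₂₁, ε₂₂, he₂, hε₂₁, hε₂₂, hε₂₁', hε₂₂', hφ₂, hcocφ₂⟩ :=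
    exists_transition_data_of_cover π' halg halgA (pullback.fst A₀.X.hom (Spec.map (CommRingCat.ofHom π'.toRingHom))) hi₀ U₂' b₂' hb₂' U₂ hU₂
  -- ★ GAP-1 on the second cover
  obtain ⟨ψ₂, hL₂, hψ₂, hcoc₂⟩ := exists_lifts_of_transition_data halg J hJJ U₂ b₂ hb₂
    (fun j l => transition (ε₂₁ j l) (ε₂₂ j l)) (RingHom.ker π') hπ'nil hφ₂ hcocφ₂
  -- ★ F2-A on the second cover
  obtain ⟨o₂, ho₂⟩ := exists_obstructionCochain (halg := halg) (U := U₂) (b := b₂) (hb := hb₂) (J := J)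
    (𝔫' := (RingHom.ker π').comap (Ideal.Quotient.mk J)) (hJ := hJJ) (e := eJ) h𝔫 ψ₂ hψ₂ hcoc₂
  have hoZ := obstructionCochain_mem_cechMZ2 halg J ((RingHom.ker π').comap (Ideal.Quotient.mk J)) hJJ hJ𝔫 eJ U b hb
    h𝔫 ψ hψ o ho
  have ho₂Z := obstructionCochain_mem_cechMZ2 halg J ((RingHom.ker π').comap (Ideal.Quotient.mk J)) hJJ hJ𝔫 eJ U₂ b₂ hb₂
    h𝔫 ψ₂ hψ₂ o₂ ho₂
  -- slot (6): the two-sided basic-open refinement of `U` and `U₂` (★ p798897)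
  have hUtop : ⨆ j, (U j).1 = ⊤ := by
    have h' : ⨆ j, (U' j).1 = ⊤ := hU'cov
    simp_rw [hU]
    rw [← Scheme.Hom.preimage_iSup, h', Scheme.Hom.preimage_top]
  have hU2top : ⨆ j, (U₂ j).1 = ⊤ := by
    show ⨆ j, ((A₀.baseChange (Spec.map (CommRingCat.ofHom π'.toRingHom))).mulN 2).left ⁻¹ᵁ (U j).1 = ⊤
    rw [← Scheme.Hom.preimage_iSup, hUtop, Scheme.Hom.preimage_top]
  obtain ⟨T, _, W, c, τ, τ', ga, ga', hWtop, hWc, hWa, hWa'⟩ :=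
    exists_finite_principal_affine_cover_basicOpen_refinement₂ U b hb hUtop U₂ hU2top
  have hτ : ∀ s, (W s).1 ≤ (U (τ s)).1 := fun s => (hWa s).le.trans ((A₀.baseChange (Spec.map (CommRingCat.ofHom π'.toRingHom))).X.left.basicOpen_le (ga s))
  have hτ' : ∀ s, (W s).1 ≤ (U₂ (τ' s)).1 := fun s => (hWa' s).le.trans ((A₀.baseChange (Spec.map (CommRingCat.ofHom π'.toRingHom))).X.left.basicOpen_le (ga' s))
  -- ===== rel₂ AT THE DATUM (★ p800719 `…of_two_covers_of_charts`), for every module map `φ : 𝒯 ⟶ N` =====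
  have hrel2 : ∀ {N : (A₀.baseChange (Spec.map (CommRingCat.ofHom π'.toRingHom))).X.left.Modules} (φ : tangentSheaf (A₀.baseChange (Spec.map (CommRingCat.ofHom π'.toRingHom))).X ⟶ N),
      CechMH2.mk (A₀.baseChange (Spec.map (CommRingCat.ofHom π'.toRingHom))).X.hom N (fun s => (W s).1)
          ⟨cechMRefineC2 (A₀.baseChange (Spec.map (CommRingCat.ofHom π'.toRingHom))).X.hom N (fun j => (U₂ j).1) (fun s => (W s).1) τ' hτ' (cechMapC2 (A₀.baseChange (Spec.map (CommRingCat.ofHom π'.toRingHom))).X.hom φ (fun j => (U₂ j).1) o₂),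
            refineMC2_mem_cechMZ2 (A₀.baseChange (Spec.map (CommRingCat.ofHom π'.toRingHom))).X.hom N (fun j => (U₂ j).1) (fun s => (W s).1) τ' hτ'
              (mapC2_mem_cechMZ2 (A₀.baseChange (Spec.map (CommRingCat.ofHom π'.toRingHom))).X.hom φ (fun j => (U₂ j).1) ho₂Z)⟩ =
        CechMH2.mk (A₀.baseChange (Spec.map (CommRingCat.ofHom π'.toRingHom))).X.hom N (fun s => (W s).1)
          ⟨cechMRefineC2 (A₀.baseChange (Spec.map (CommRingCat.ofHom π'.toRingHom))).X.hom N (fun j => (U j).1) (fun s => (W s).1) τ hτ (cechMapC2 (A₀.baseChange (Spec.map (CommRingCat.ofHom π'.toRingHom))).X.hom φ (fun j => (U j).1) o),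
            refineMC2_mem_cechMZ2 (A₀.baseChange (Spec.map (CommRingCat.ofHom π'.toRingHom))).X.hom N (fun j => (U j).1) (fun s => (W s).1) τ hτ
              (mapC2_mem_cechMZ2 (A₀.baseChange (Spec.map (CommRingCat.ofHom π'.toRingHom))).X.hom φ (fun j => (U j).1) hoZ)⟩ := fun φ =>
    CechMH2.mk_refineC2_mapC2_eq_of_two_covers_of_charts (π' := π') (halg := halg) (halgA := halgA)
      (i := pullback.fst A₀.X.hom (Spec.map (CommRingCat.ofHom π'.toRingHom))) (hi := hi₀) (hJ := hJJ) (h𝔫π := hπ'nil) (h𝔫 := h𝔫)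
      (U' := U') (b' := b') (hb' := hb') (U := U) (hU := hU) (b := b) (hb := hb) (e := e) (he := he)
      (ε₁ := ε₁) (ε₂ := ε₂) (hε₁ := hε₁) (hε₂ := hε₂) (hφ := hφ) (ψ := ψ) (hL := hL) (hψ := hψ)
      (U'' := U₂') (b'' := b₂') (hb'' := hb₂') (U₂ := U₂) (hU₂ := hU₂) (b₂ := b₂) (hb₂ := hb₂) (e'' := e₂) (he'' := he₂)
      (ε''₁ := ε₂₁) (ε''₂ := ε₂₂) (hε''₁ := hε₂₁) (hε''₂ := hε₂₂) (hφ'' := hφ₂) (ψ'' := ψ₂) (hL'' := hL₂) (hψ'' := hψ₂)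
      (V := W) (c := c) (hc := hWc) (τ := τ) (hτ := hτ) (a := ga) (hVa := hWa) (τ₂ := τ') (hτ₂ := hτ') (a₂ := ga')
      (hVa₂ := hWa') (hJ𝔫 := hJ𝔫) (eJ := eJ) (o := o) (ho := ho) (o'' := o₂) (ho'' := ho₂) (hnil := hnil)
      (hoZ := hoZ) (ho''Z := ho₂Z) (φ := φ)
  have hUW : ∀ i, (U i).1 ≤ ⨆ s, (W s).1 := fun i => hWtop.symm ▸ le_top
  -- slot (1): the tangent frame of the abelian variety (★ p796982)
  obtain ⟨-, πf, σf, hπσ, -, -, -⟩ := AbelianSchemeOver.exists_frameMaps_tangentSheaf_of_isLocalRing (A₀.baseChange (Spec.map (CommRingCat.ofHom π'.toRingHom))) hA₀'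
  -- ===== (D2): the chart-lift maps of `[2]` — DISCHARGED by ★ p801218 `exists_chartLifts_of_morphism` (F0P1c-p01 (g3)) =====
  obtain ⟨F, hF, hFψ⟩ := exists_chartLifts_of_morphism π' halg halgA
    (pullback.fst A₀.X.hom (Spec.map (CommRingCat.ofHom π'.toRingHom))) halg halgA
    (pullback.fst A₀.X.hom (Spec.map (CommRingCat.ofHom π'.toRingHom)))
    ((A₀.baseChange (Spec.map (CommRingCat.ofHom π'.toRingHom))).mulN 2) (A₀.mulN 2) hnat hJJ (RingHom.ker π') le_rfl
    U b hb U₂ (fun _ => rfl) (fun j => (U' j).1) hU (fun j => (U₂' j).1) (fun j => (hU₂ j).le) (fun _ => le_rfl)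
    e he ε₁ ε₂ hε₁ hε₂ e₂ he₂ ε₂₁ ε₂₂ hε₂₁ hε₂₂ ψ hL ψ₂ hL₂
  -- ===== the slots: `p a := ([2]^*(π_a o))|_W`, `q a := (π_a o₂)|_W`; rel₁ = ★ p799906, rel₂ = ★ p800719 (hrel2), rel₃ = `hrel₃`; then `GAP2_of_slots` =====
  exact exists_cechMD1_eq_of_scaling_slots (halg := halg) (J := J) (𝔫' := ((RingHom.ker π').comap (Ideal.Quotient.mk J))) (hJ := hJJ) (hJ𝔫 := hJ𝔫)
    (e := eJ) (U := U) (b := b) (hb := hb) h𝔫 ψ hψ o ho πf σf hπσ (fun s => (W s).1) τ hτ hUW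
    (fun a => ⟨cechMRefineC2 (A₀.baseChange (Spec.map (CommRingCat.ofHom π'.toRingHom))).X.hom (SheafOfModules.unit (A₀.baseChange (Spec.map (CommRingCat.ofHom π'.toRingHom))).X.left.ringCatSheaf) (preimageFamily ((A₀.baseChange (Spec.map (CommRingCat.ofHom π'.toRingHom))).mulN 2).left (fun j => (U j).1)) (fun s => (W s).1) τ' hτ'
        (cechComapC2 (A₀.baseChange (Spec.map (CommRingCat.ofHom π'.toRingHom))).X.hom (A₀.baseChange (Spec.map (CommRingCat.ofHom π'.toRingHom))).X.hom ((A₀.baseChange (Spec.map (CommRingCat.ofHom π'.toRingHom))).mulN 2).left (Over.w ((A₀.baseChange (Spec.map (CommRingCat.ofHom π'.toRingHom))).mulN 2)) (fun j => (U j).1)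
          (cechMapC2 (A₀.baseChange (Spec.map (CommRingCat.ofHom π'.toRingHom))).X.hom (πf a) (fun j => (U j).1) o)),
      refineMC2_mem_cechMZ2 (A₀.baseChange (Spec.map (CommRingCat.ofHom π'.toRingHom))).X.hom (SheafOfModules.unit (A₀.baseChange (Spec.map (CommRingCat.ofHom π'.toRingHom))).X.left.ringCatSheaf) (preimageFamily ((A₀.baseChange (Spec.map (CommRingCat.ofHom π'.toRingHom))).mulN 2).left (fun j => (U j).1)) (fun s => (W s).1) τ' hτ'
        (comapC2_mem_cechMZ2 (A₀.baseChange (Spec.map (CommRingCat.ofHom π'.toRingHom))).X.hom (A₀.baseChange (Spec.map (CommRingCat.ofHom π'.toRingHom))).X.hom ((A₀.baseChange (Spec.map (CommRingCat.ofHom π'.toRingHom))).mulN 2).left (Over.w ((A₀.baseChange (Spec.map (CommRingCat.ofHom π'.toRingHom))).mulN 2)) (fun j => (U j).1)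
          (mapC2_mem_cechMZ2 (A₀.baseChange (Spec.map (CommRingCat.ofHom π'.toRingHom))).X.hom (πf a) (fun j => (U j).1) hoZ))⟩)
    (fun a => ⟨cechMRefineC2 (A₀.baseChange (Spec.map (CommRingCat.ofHom π'.toRingHom))).X.hom (SheafOfModules.unit (A₀.baseChange (Spec.map (CommRingCat.ofHom π'.toRingHom))).X.left.ringCatSheaf) (fun j => (U₂ j).1) (fun s => (W s).1) τ' hτ' (cechMapC2 (A₀.baseChange (Spec.map (CommRingCat.ofHom π'.toRingHom))).X.hom (πf a) (fun j => (U₂ j).1) o₂),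
      refineMC2_mem_cechMZ2 (A₀.baseChange (Spec.map (CommRingCat.ofHom π'.toRingHom))).X.hom (SheafOfModules.unit (A₀.baseChange (Spec.map (CommRingCat.ofHom π'.toRingHom))).X.left.ringCatSheaf) (fun j => (U₂ j).1) (fun s => (W s).1) τ' hτ' (mapC2_mem_cechMZ2 (A₀.baseChange (Spec.map (CommRingCat.ofHom π'.toRingHom))).X.hom (πf a) (fun j => (U₂ j).1) ho₂Z)⟩)
    (fun a => AbelianSchemeOver.cechMH2_mk_refine_comap_mulN_two_map_eq_two_smul (A₀.baseChange (Spec.map (CommRingCat.ofHom π'.toRingHom))) halg hA₀' J ((RingHom.ker π').comap (Ideal.Quotient.mk J)) hJJ hJ𝔫 h𝔫 eJ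
      U b hb U₂ (fun _ => rfl) ψ hψ ψ₂ hψ₂ o ho o₂ ho₂ F hF hFψ hoZ ho₂Z (πf a) (fun s => (W s).1) τ' hτ')
    (fun a => hrel2 (πf a))
    (fun a => hrel₃ ⟨cechMapC2 (A₀.baseChange (Spec.map (CommRingCat.ofHom π'.toRingHom))).X.hom (πf a) (fun j => (U j).1) o, mapC2_mem_cechMZ2 (A₀.baseChange (Spec.map (CommRingCat.ofHom π'.toRingHom))).X.hom (πf a) (fun j => (U j).1) hoZ⟩ W τ τ' ga ga' hWa hWa')

end Literature.AlgebraicGeometry.Deformation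

end
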